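import Summits.QuantumFields.YangMills.Theorems.BalabanUVNodesN06Eq3132DecayFromMajorantKnitQ
import Literature.MathematicalPhysics.QuantumFieldTheory.Balaban1983to89.B9Eq3132CoerciveFromGAR

/-!
# BalabanUVNodes ∕ N06 ([B9], `Dag.B9_main`) — ROW 26 AT THE KNIT PAIR, PIECE 4: THE COERCIVITY TRANSFER ALONG `(Mα₀)`-SMALL DIFFERENCE MAJORANTS FOR THE
# Λ-NORMALISED `Q T(U) Q⋆` AT PRINT's KNIT AVERAGING (print's perturbation route (3.130) ∕ (3.138)), over the class-parametric carrier `bg9YR … G R₁ R₂`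

Track A of `YM-PLAN.md` (cell `pub-ymgap`, HUMAN RULING D-0062), node **N06** = [Balaban1985BackgroundPropagators]; piece 4 of «P-Q26-knit» (KA's displayed `s3132K`; seat
`pub-ymgap-dag-n06-l` g37, 2026-08-30).  dag-n06-i's `B9Eq3132CoerciveFromGAR.coerciveUnder_of_subMajorants_R` re-pressed for def-Y's `QGQOfQY x.toKIdx (𝔮 x) (𝔮⋆ x) (T x) U` at
letter families pinned to the knit pair (`𝔮 x U = QknitY x.toKIdx U`, `𝔮⋆ x U = adjTrY (QknitY x.toKIdx U)`), the contractive taxi transports replaced by piece 2's one-configuration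
entry bound `abs_normMatY_QGQOfQY_le_of_hasMajorant_knit` read on the member's local class through `hRP` and the x-free knit numerics; the Schur step
(`form_abs_le_of_entry_decay`) and the perturbation step (`QGQInverse.coercive_of_form_perturbation`) BY NAME.  HONEST FRAMING: composition of landed theorems; the coercivity
of `Q T₀ Q⋆` and the difference majorants are HYPOTHESES; nothing of [B9] ∕ [4] asserted; COUNT-NEUTRAL; N06 NOT discharged; nothing continuum ∕ OS ∕ mass gap ∕ Clay.
0 `def`, 0 `sorry`.  [cite: Balaban1985BackgroundPropagators, (3.132) p.422, Thm 3.12 p.423 (prefix), (3.130) p.421, (3.138) p.423, (3.115) p.418, (3.35) p.396;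
Balaban1984PropagatorsII, (2.147) p.249, (2.142) p.248, Lemma 2.1 (2.60)–(2.61) p.234; Balaban1985Averaging, (139)–(147) pp.39–40]
-/

noncomputable section

namespace Summit.QuantumFields.YangMills.BalabanUVNodes.N06Eq3132CoerciveFromGAKnitQ

open scoped Matrix.Norms.L2Operator
open Literature.MathematicalPhysics.QuantumFieldTheory.Balaban1983to89
open Literature.MathematicalPhysics.QuantumFieldTheory.Balaban1983to89.Node00
open Literature.MathematicalPhysics.QuantumFieldTheory.Balaban1983to89.B6RandomWalk (HasMajorant)
open Literature.MathematicalPhysics.QuantumFieldTheory.Balaban1983to89.B9CoReadingCoords (XBK blkBK GcoK)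
open Literature.MathematicalPhysics.QuantumFieldTheory.Balaban1983to89.B6Ineq2142KLevelV1 (lvl β)
open Literature.MathematicalPhysics.QuantumFieldTheory.Balaban1983to89.B9Eq3132StepDifference (normMatY_sub)
open Literature.MathematicalPhysics.QuantumFieldTheory.Balaban1983to89.B9Eq3132CoerciveFromGA (form_abs_le_of_entry_decay)
open Literature.MathematicalPhysics.QuantumFieldTheory.Balaban1983to89.B9Thm39ReadingCoords (basisBound39)
open Literature.MathematicalPhysics.QuantumFieldTheory.Balaban1983to89.B9Eq3132RingInverseReading (normMatY dimConstY' dimConstY'_pos)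
open Literature.MathematicalPhysics.QuantumFieldTheory.Balaban1983to89.B6KLevelCensusIndexV1 (KIdx kGeo)
open Literature.MathematicalPhysics.QuantumFieldTheory.Balaban1983to89.B6GlobalChartV1 (blkV1)
open Literature.MathematicalPhysics.QuantumFieldTheory.Balaban1983to89.B9Thm34Ext (toB6)
open Literature.MathematicalPhysics.QuantumFieldTheory.Balaban1983to89.B9PinMembersKLevelV1 (MemberY geo9Y bg9Y)
open Literature.MathematicalPhysics.QuantumFieldTheory.Balaban1983to89.B9BackgroundsKLevelV1R (RegFamY bg9YR)
open Literature.MathematicalPhysics.QuantumFieldTheory.Balaban1983to89.B9GeoLemma21KLevelV1 (geo9K_len_pos rowSum261_geo9Y geo9Y_dist_comm)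
open Literature.MathematicalPhysics.QuantumFieldTheory.Balaban1983to89.B9GeoNormsKLevelV1 (geo9K)
open Literature.MathematicalPhysics.QuantumFieldTheory.Balaban1983to89.B9RWSumsReadsNbr (nbr)
open Literature.MathematicalPhysics.QuantumFieldTheory.Balaban1983to89.B9Eq3132NuReading (lamInvY)
open Literature.MathematicalPhysics.QuantumFieldTheory.Balaban1983to89.B9Eq3132CTInputs (CoerciveUnder)
open Literature.MathematicalPhysics.QuantumFieldTheory.Balaban1983to89.B9Eq3132ScalarIndex (geoComap)
open Literature.MathematicalPhysics.QuantumFieldTheory.Balaban1983to89.Node00.OpsYQLetter (QLetterY QsLetterY adjTrY)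
open Literature.MathematicalPhysics.QuantumFieldTheory.Balaban1983to89.B9Eq316AveragingTransposeZd (alphaQ)
open Literature.MathematicalPhysics.QuantumFieldTheory.Balaban1983to89.B9Eq3115KnitLetterY (QknitY)
open Literature.MathematicalPhysics.QuantumFieldTheory.Balaban1983to89.B9Eq3115KnitLetterYOnto (kCol kCol_nonneg)
open Literature.MathematicalPhysics.QuantumFieldTheory.Balaban1983to89.B9C2FormBoxRegimeY (Kpl)
open Literature.MathematicalPhysics.QuantumFieldTheory.Balaban1983to89.B9BackgroundsKLevelV1P (bg9KP)
open Literature.MathematicalPhysics.QuantumFieldTheory.Balaban1983to89.B7Prop2Explicit (unitaryUnits)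
open Summit.QuantumFields.YangMills.BalabanUVNodes.N06Eq3132DecayFromMajorantKnitQ (abs_normMatY_QGQOfQY_le_of_hasMajorant_knit)
open Matrix
open QGQInverse (Coercive coercive_of_form_perturbation)

variable {N : ℕ} [Nonempty (Fin N)]
variable {κ : Type} [Fintype κ] [DecidableEq κ] {Ff : Type} [Fintype Ff] [DecidableEq Ff]
variable {d ℓ : ℕ} {hd : 1 ≤ d + 1} {hL : Odd (ℓ + 1) ∧ 1 < ℓ + 1} {b₀ b₁ : ℝ} {Mstar : ℕ}
variable {G : Subgroup (Matrix (Fin N) (Fin N) ℂ)ˣ}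

/-- `𝔮 (T − T₀)(U) 𝔮⋆ = 𝔮T(U)𝔮⋆ − 𝔮T₀(U)𝔮⋆` (linearity). [cite: Balaban1985BackgroundPropagators, (3.130) p.421, (3.132) p.422, bookkeeping] -/
theorem QGQOfQY_sub {𝔸 : Type} [NormedRing 𝔸] [NormedAlgebra ℂ 𝔸] [CompleteSpace 𝔸] (i : KIdx d ℓ hd hL b₀ b₁)
    (𝔮 : QLetterY 𝔸 i) (𝔮s : QsLetterY 𝔸 i) (T T₀ : BondOpY 𝔸 i) (U : CfgY 𝔸 i) :
    QGQOfQY i 𝔮 𝔮s (T - T₀) U = QGQOfQY i 𝔮 𝔮s T U - QGQOfQY i 𝔮 𝔮s T₀ U := by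
  simp only [QGQOfQY, Pi.sub_apply, LinearMap.sub_comp, LinearMap.comp_sub]

variable (R₁ R₂ : RegFamY d ℓ hd hL b₀ b₁ Mstar (Matrix (Fin N) (Fin N) ℂ))

/-- ★★ **COERCIVITY TRANSFER ALONG `(Mα₀)`-SMALL DIFFERENCE MAJORANTS AT THE KNIT PAIR, OVER `bg9YR … G R₁ R₂`** (the knit twin of n06-i's `coerciveUnder_of_subMajorants_R`, same
proof text): if the Λ-normalised `Q T₀(U) Q⋆` is coercive (constant `γ`) under the carrier's prefix and the coordinate models of `T − T₀` have [4]-(2.51) majorants `(C·Mα₀)(Lʲη)²e^{−δd}`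
there, then — for letter families pinned to the knit pair, `G ≤ U(N)`, the regime bridge `hRP` (`c₀ ≤ 10`), x-free numerics `0 < α₀′ ≤ α_Q`, `hKpl : 0 ≤ a ≤ aK ⇒ K_pl(a)L⁴ < α₀′` — the
Λ-normalised `Q T(U) Q⋆` is coercive with constant `γ∕2` above `max(M₄, M₂, M_L, (d+3)log L∕(δ(2L²−1)))` for `Mα₀ ≤ min(a₀, a₂, aK, γ∕(2(K′+1)))`.
[cite: Balaban1985BackgroundPropagators, (3.132) p.422, Thm 3.12 p.423, (3.130) p.421, (3.115) p.418, (3.35) p.396; Balaban1984PropagatorsII, (2.147) p.249, (2.142) p.248, (2.60)–(2.61) p.234] -/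
theorem coerciveUnder_of_subMajorants_knit_R (hGU : G ≤ unitaryUnits (Matrix (Fin N) (Fin N) ℂ))
    [∀ x : MemberY d ℓ hd hL b₀ b₁ Mstar, Fintype (geo9Y x).Site]
    [∀ x : MemberY d ℓ hd hL b₀ b₁ Mstar, DecidableEq (geo9Y x).Site] (bK : Module.Basis κ ℝ (Matrix (Fin N) (Fin N) ℂ)) (b : Module.Basis Ff ℝ (Matrix (Fin N) (Fin N) ℂ))
    {c35 : ℝ} (T T₀ : ∀ x : MemberY d ℓ hd hL b₀ b₁ Mstar, BondOpY (Matrix (Fin N) (Fin N) ℂ) x.toKIdx)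
    (𝔮 : ∀ x : MemberY d ℓ hd hL b₀ b₁ Mstar, QLetterY (Matrix (Fin N) (Fin N) ℂ) x.toKIdx)
    (𝔮s : ∀ x : MemberY d ℓ hd hL b₀ b₁ Mstar, QsLetterY (Matrix (Fin N) (Fin N) ℂ) x.toKIdx)
    (h𝔮 : ∀ (x : MemberY d ℓ hd hL b₀ b₁ Mstar) (U : CfgY (Matrix (Fin N) (Fin N) ℂ) x.toKIdx), 𝔮 x U = QknitY x.toKIdx U)
    (h𝔮s : ∀ (x : MemberY d ℓ hd hL b₀ b₁ Mstar) (U : CfgY (Matrix (Fin N) (Fin N) ℂ) x.toKIdx), 𝔮s x U = adjTrY (QknitY x.toKIdx U))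
    {c₀ : ℝ} (hc : c₀ ≤ 10)
    (hRP : ∀ (x : MemberY d ℓ hd hL b₀ b₁ Mstar) (α₀ : ℝ) (U : (bg9YR (Matrix (Fin N) (Fin N) ℂ) G R₁ R₂ x).Cfg),
      (bg9YR (Matrix (Fin N) (Fin N) ℂ) G R₁ R₂ x).Reg335 c35 α₀ U → (bg9KP (Matrix (Fin N) (Fin N) ℂ) G x.toKIdx).Reg335 c₀ α₀ U)
    {α₀' : ℝ} (hα' : 0 < α₀') (hαQ : α₀' ≤ alphaQ (d + 1) (ℓ + 1)) {aK : ℝ} (haK : 0 < aK)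
    (hKpl : ∀ (x : MemberY d ℓ hd hL b₀ b₁ Mstar) (a : ℝ), 0 ≤ a → a ≤ aK → Kpl x.toKIdx a * (kGeo x.toKIdx).L ^ 4 < α₀')
    {bI : ∀ x : MemberY d ℓ hd hL b₀ b₁ Mstar, FBondY x.toKIdx → IBondY x.toKIdx}
    (hlev : ∀ (x : MemberY d ℓ hd hL b₀ b₁ Mstar) (f : FBondY x.toKIdx), lvl x.hN x.D x.hk (bI x f) = (blkV1 x.hN x.D f).1.1)
    (hβ1 : ∀ (x : MemberY d ℓ hd hL b₀ b₁ Mstar) (f : FBondY x.toKIdx), (B6Geom246MultiLevelTorus.geomT x.D).dist (β x.hN x.D x.hk (bI x f)) (blkV1 x.hN x.D f) ≤ 1)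
    {mN : ℕ} (hnbr : ∀ (x : MemberY d ℓ hd hL b₀ b₁ Mstar) (y : (geo9Y x).Site), (nbr (geo9Y x) ((ℓ : ℝ) + 4) y).card ≤ mN)
    {R : MemberY d ℓ hd hL b₀ b₁ Mstar → ℝ} {H : MemberY d ℓ hd hL b₀ b₁ Mstar → Prop}
    (hco : CoerciveUnder c35 (fun x : MemberY d ℓ hd hL b₀ b₁ Mstar => geoComap (geo9Y x) (Prod.fst : (geo9Y x).Site × Ff → (geo9Y x).Site))
      (bg9YR (Matrix (Fin N) (Fin N) ℂ) G R₁ R₂) (fun x U => normMatY b (lamInvY x.toKIdx) (QGQOfQY x.toKIdx (𝔮 x) (𝔮s x) (T₀ x) U)))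
    (hsub : ∃ M₂ a₂ C δ : ℝ, 0 < M₂ ∧ 0 < a₂ ∧ 0 ≤ C ∧ 0 < δ ∧
      ∀ x : MemberY d ℓ hd hL b₀ b₁ Mstar, M₂ ≤ (geo9Y x).M → ∀ α₀ : ℝ, 0 < α₀ → (geo9Y x).M * α₀ ≤ a₂ →
        ∀ U : (bg9YR (Matrix (Fin N) (Fin N) ℂ) G R₁ R₂ x).Cfg,
          (bg9YR (Matrix (Fin N) (Fin N) ℂ) G R₁ R₂ x).Reg335 c35 α₀ U → (bg9YR (Matrix (Fin N) (Fin N) ℂ) G R₁ R₂ x).Reg336 c35 α₀ U →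
          HasMajorant (g := toB6 (geo9Y x) (R x) (H x)) (blkBK x.toKIdx (bI x)) (GcoK x.toKIdx bK (bg9YR (Matrix (Fin N) (Fin N) ℂ) G R₁ R₂ x) (fun U => U) (T x - T₀ x) U)
            (fun a a' => C * ((geo9Y x).M * α₀) * (geo9Y x).len a ^ 2 * Real.exp (-(δ * (geo9Y x).dist a a')))) :
    CoerciveUnder c35 (fun x : MemberY d ℓ hd hL b₀ b₁ Mstar => geoComap (geo9Y x) (Prod.fst : (geo9Y x).Site × Ff → (geo9Y x).Site))
      (bg9YR (Matrix (Fin N) (Fin N) ℂ) G R₁ R₂) (fun x U => normMatY b (lamInvY x.toKIdx) (QGQOfQY x.toKIdx (𝔮 x) (𝔮s x) (T x) U)) := by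
  obtain ⟨M₄, a₀, γ, hM₄, ha₀, hγ, hco⟩ := hco
  obtain ⟨M₂, a₂, C, δ, hM₂, ha₂, hC, hδ, hmaj⟩ := hsub
  -- the knit factor in front of the majorant constant
  set cK : ℝ := (1 + kCol (d + 1) (ℓ + 1) * α₀' * (2 * ((d : ℝ) + 1))) * (N : ℝ) ^ 4 * (1 + kCol (d + 1) (ℓ + 1) * α₀') with hcK
  have hkc : 0 ≤ kCol (d + 1) (ℓ + 1) * α₀' := mul_nonneg (kCol_nonneg _ _) hα'.le
  have hcK0 : 0 ≤ cK := by rw [hcK]; positivity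
  -- (2.61) at rate δ/2 for the record geometry
  obtain ⟨ML, c, hrow0⟩ := rowSum261_geo9Y (d := d) (ℓ := ℓ) (hd := hd) (hL := hL) (b₀ := b₀) (b₁ := b₁) (Mstar := Mstar) (δ / 2) (half_pos hδ)
  set c' : ℝ := max c 0 with hc'
  have hc'0 : 0 ≤ c' := le_max_right _ _
  -- the (2.60) threshold and the perturbation constant
  set L : ℝ := ((ℓ + 1 : ℕ) : ℝ) with hLdef
  set MT : ℝ := ((d : ℝ) + 3) * Real.log L / (δ * (2 * ((ℓ : ℝ) + 1) ^ 2 - 1)) with hMT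
  have hden : 0 < δ * (2 * ((ℓ : ℝ) + 1) ^ 2 - 1) := mul_pos hδ (by nlinarith [(Nat.cast_nonneg ℓ : (0 : ℝ) ≤ ℓ)])
  set Kb : ℝ := basisBound39 b * (‖(b.equivFunL : Matrix (Fin N) (Fin N) ℂ →L[ℝ] (Ff → ℝ))‖ / dimConstY' b) * (mN * Real.exp (2 * (δ * ((ℓ : ℝ) + 4)))) *
    (((ℓ + 1 : ℕ) : ℝ)) ^ (((d : ℝ) + 3) / 2) with hKb
  have hKb0 : 0 ≤ Kb := by
    rw [hKb]
    have : 0 ≤ basisBound39 b := Finset.sum_nonneg fun _ _ => norm_nonneg _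
    have := dimConstY'_pos b
    positivity
  set K' : ℝ := Kb * (cK * C) * (Fintype.card Ff) * c' with hK'
  have hK'0 : 0 ≤ K' := by rw [hK']; exact mul_nonneg (mul_nonneg (mul_nonneg hKb0 (mul_nonneg hcK0 hC)) (Nat.cast_nonneg _)) hc'0
  set a₃ : ℝ := min (min (min a₀ a₂) aK) (γ / (2 * (K' + 1))) with ha₃
  have ha₃0 : 0 < a₃ := lt_min (lt_min (lt_min ha₀ ha₂) haK) (div_pos hγ (by positivity))
  refine ⟨max (max M₄ M₂) (max ML MT), a₃, γ / 2, lt_of_lt_of_le hM₄ ((le_max_left _ _).trans (le_max_left _ _)), ha₃0, half_pos hγ,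
    fun x hM α₀ hα₀ hMa U hU hU' => ?_⟩
  have hM4 : M₄ ≤ (geo9Y x).M := ((le_max_left _ _).trans (le_max_left _ _)).trans hM
  have hM2 : M₂ ≤ (geo9Y x).M := ((le_max_right _ _).trans (le_max_left _ _)).trans hM
  have hMLx : ML ≤ (geo9Y x).M := ((le_max_left _ _).trans (le_max_right _ _)).trans hM
  have hMTx : MT ≤ (geo9Y x).M := ((le_max_right _ _).trans (le_max_right _ _)).trans hM
  have hMa0 : (geo9Y x).M * α₀ ≤ a₀ := hMa.trans ((min_le_left _ _).trans ((min_le_left _ _).trans (min_le_left _ _)))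
  have hMa2 : (geo9Y x).M * α₀ ≤ a₂ := hMa.trans ((min_le_left _ _).trans ((min_le_left _ _).trans (min_le_right _ _)))
  have hMaK : (geo9Y x).M * α₀ ≤ aK := hMa.trans ((min_le_left _ _).trans (min_le_right _ _))
  have hMaγ : (geo9Y x).M * α₀ ≤ γ / (2 * (K' + 1)) := hMa.trans (min_le_right _ _)
  have hMα0 : 0 ≤ (geo9Y x).M * α₀ := mul_nonneg (hM₄.le.trans hM4) hα₀.le
  have hS := hco x hM4 α₀ hα₀ hMa0 U hU hU'
  have h0 := hmaj x hM2 α₀ hα₀ hMa2 U hU hU'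
  -- the knit regime at this member and configuration
  have hMα : 0 ≤ (kGeo x.toKIdx).M * α₀ := hMα0
  have hKx : Kpl x.toKIdx ((kGeo x.toKIdx).M * α₀) * (kGeo x.toKIdx).L ^ 4 < α₀' := hKpl x _ hMα hMaK
  -- the (2.60) threshold in the member's spelling
  have hlog : ((d : ℝ) + 3) * Real.log (geo9K x.toKIdx).L ≤ δ * (2 * ((ℓ : ℝ) + 1) ^ 2 - 1) * (geo9Y x).M := by
    have h1 : ((d : ℝ) + 3) * Real.log L = MT * (δ * (2 * ((ℓ : ℝ) + 1) ^ 2 - 1)) := by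
      rw [hMT, div_mul_cancel₀ _ hden.ne']
    have hLx : (geo9K x.toKIdx).L = L := rfl
    rw [hLx, h1, mul_comm]
    exact mul_le_mul_of_nonneg_left hMTx hden.le
  -- the entries of the normalised difference
  have hCM : 0 ≤ C * ((geo9Y x).M * α₀) := mul_nonneg hC hMα0
  have hE : ∀ a e : (geo9Y x).Site × Ff,
      |(normMatY (X := (geo9Y x).Site) b (lamInvY x.toKIdx) (QGQOfQY x.toKIdx (𝔮 x) (𝔮s x) (T x) U) -
          normMatY (X := (geo9Y x).Site) b (lamInvY x.toKIdx) (QGQOfQY x.toKIdx (𝔮 x) (𝔮s x) (T₀ x) U)) a e| ≤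
        Kb * (cK * (C * ((geo9Y x).M * α₀))) * Real.exp (-(δ / 2 * (geo9Y x).dist a.1 e.1)) := by
    have e0 : normMatY (X := (geo9Y x).Site) b (lamInvY x.toKIdx) (QGQOfQY x.toKIdx (𝔮 x) (𝔮s x) (T x) U) -
          normMatY (X := (geo9Y x).Site) b (lamInvY x.toKIdx) (QGQOfQY x.toKIdx (𝔮 x) (𝔮s x) (T₀ x) U) =
        normMatY (X := (geo9Y x).Site) b (lamInvY x.toKIdx) (QGQOfQY x.toKIdx (𝔮 x) (𝔮s x) (T x - T₀ x) U) := by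
      rw [← normMatY_sub]
      exact congrArg _ (QGQOfQY_sub x.toKIdx (𝔮 x) (𝔮s x) (T x) (T₀ x) U).symm
    intro a e
    have hK := abs_normMatY_QGQOfQY_le_of_hasMajorant_knit (κ := κ) x.toKIdx (instF := (inferInstance : Fintype (geo9Y x).Site))
      (instD := (inferInstance : DecidableEq (geo9Y x).Site)) bK b
      (B := bg9YR (Matrix (Fin N) (Fin N) ℂ) G R₁ R₂ x) (fun U => U) (T x - T₀ x) (𝔮 x) (𝔮s x) U (h𝔮 x U) (h𝔮s x U) hGU hc hMα (hRP x α₀ U hU)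
      hα' hαQ hKx (hlev x) (hβ1 x) (hnbr x) hCM hδ hlog h0 a e
    rw [e0, hKb, hcK]
    exact hK
  -- the form bound `K′(Mα₀)‖v‖² ≤ (γ/2)‖v‖²`
  have hrow : ∀ y : (geo9Y x).Site, ∑ y', Real.exp (-(δ / 2 * (geo9Y x).dist y y')) ≤ c' := fun y => (hrow0 x hMLx y).trans (le_max_left _ _)
  have hform : ∀ v : (geo9Y x).Site × Ff → ℝ,
      |v ⬝ᵥ ((normMatY (X := (geo9Y x).Site) b (lamInvY x.toKIdx) (QGQOfQY x.toKIdx (𝔮 x) (𝔮s x) (T x) U) -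
          normMatY (X := (geo9Y x).Site) b (lamInvY x.toKIdx) (QGQOfQY x.toKIdx (𝔮 x) (𝔮s x) (T₀ x) U)) *ᵥ v)| ≤ γ / 2 * (v ⬝ᵥ v) := by
    intro v
    have h := form_abs_le_of_entry_decay (X := (geo9Y x).Site) (F := Ff)
      (normMatY (X := (geo9Y x).Site) b (lamInvY x.toKIdx) (QGQOfQY x.toKIdx (𝔮 x) (𝔮s x) (T x) U) -
        normMatY (X := (geo9Y x).Site) b (lamInvY x.toKIdx) (QGQOfQY x.toKIdx (𝔮 x) (𝔮s x) (T₀ x) U))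
      (geo9Y x).dist (K := Kb * (cK * (C * ((geo9Y x).M * α₀)))) (σ := δ / 2) (c := c')
      (mul_nonneg hKb0 (mul_nonneg hcK0 (mul_nonneg hC hMα0))) (geo9Y_dist_comm x) hrow hE v
    refine h.trans (mul_le_mul_of_nonneg_right ?_ (Literature.LinearAlgebra.Matrix.dotProduct_self_nonneg_real v))
    have h2 : Kb * (cK * (C * ((geo9Y x).M * α₀))) * (Fintype.card Ff) * c' = K' * ((geo9Y x).M * α₀) := by rw [hK']; ring
    rw [h2]
    have h3 : K' * ((geo9Y x).M * α₀) ≤ K' * (γ / (2 * (K' + 1))) := mul_le_mul_of_nonneg_left hMaγ hK'0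
    have h4 : K' * (γ / (2 * (K' + 1))) ≤ γ / 2 := by
      have hK1 : 0 < K' + 1 := by linarith
      have hq : K' / (K' + 1) ≤ 1 := by rw [div_le_one hK1]; linarith
      calc K' * (γ / (2 * (K' + 1))) = γ / 2 * (K' / (K' + 1)) := by field_simp
        _ ≤ γ / 2 * 1 := mul_le_mul_of_nonneg_left hq (by positivity)
        _ = γ / 2 := mul_one _
    exact h3.trans h4
  have hres := coercive_of_form_perturbation hS hform
  have hγ2 : γ - γ / 2 = γ / 2 := by ring
  rw [hγ2] at hres
  exact hres

end Summit.QuantumFields.YangMills.BalabanUVNodes.N06Eq3132CoerciveFromGAKnitQ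

end
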